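import Summits.QuantumFields.BalabanUV.Beta.SymAveragingHessianCounts
import Summits.QuantumFields.BalabanUV.Beta.GAN24.VHClassCurrentSym

/-!
# `BalabanUV.Beta.GAN24.SymVHClassCurrentSym` — binder row G-an2-4 ∕ (CONV-C), TRANSFER-III, the (III′) twin of this lineage's «VH LETTER» `VHClassCurrentSym` (g69):
# **THE SLOT↔LEG-SYMMETRISED TWO-DATUM CONTRACTION OF an1's SYMMETRISED BORDER TABLE `symVhSAt ρ d L` VANISHES FOR EXIT-FACE-SUPPORTED SINGLE-COORDINATE DATA** —
# for `h`, `s : ℤ → ℝ` supported on `{n : n % L = L − 1}`, in-block root, every free leg `(p, a)`: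
# `Σ'_q h(q_β)·Σ'_u s(u_ν)·symVhSAt ρ d L ν u q p (inl β) a + Σ'_q s(q_ν)·Σ'_u h(u_β)·symVhSAt ρ d L β u q p (inl ν) a = 0`.

NOT IN PRINT; OUR BOOKKEEPING ([folklore] finite algebra over an1's DEFINITIONS BY NAME: `SymAveragingHessianCounts.symVhSAt ∕ symVhKerAt ∕ symVhCountAt ∕ symLinCountAt ∕ symLinKerAt ∕
symHessCountAt_swap ∕ symLinU_real ∕ symLinU_single ∕ lettersIn_gammaPAt ∕ symVhKerAt_eq_zero_left ∕ _right ∕ symVhSAt_symm`, `SymmetrisedAxialPotential.symLinAvgAt ∕ symAxial_sub ∕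
symLinAvgAt_grad`, `LinearGaugeVH.nearBox ∕ mem_nearBox`, and this lineage's g69 window lemmas `VHClassCurrentSym.emod_window ∕ sum_range_face`; G-an2-4 CRUX TEAM (2), leaf prover
`b2b-balaban-gan24-formalise-leaf-04`, gen 77).  HONEST FRAMING (cell contract, verbatim): «discharging `BetaPertH` makes Bałaban's UV stability UNCONDITIONAL — a real constructive-QFT
result; it is NOT the continuum limit and NOT the Clay problem.»  HONEST DEPENDENCY (verbatim): «continuum YM on T⁴ ⇐ BetaPertH ∧ nine spine estimates (0/9 proved); BetaPertH ⇐ (D1) ∧ (D4) ∧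
CAP+tail; G-an2-4 gates asym, D1 and NE2/3/4.»

WHY.  The (III′) current-symmetry tower (this lineage's F5 `CurrentSymTower` at the comb-chart slot data `SpureRecOf d Lc (symVhSAt ρ_c d Lc) (symHessFFAt ρ_c Lc) (GcombSh Lc)` — the ONE letter
`hCS` of leaf-02 g78's (G) `CombForcingPairForm` §5) meets the BORDER sector at multiplier free legs, where at (III′) an1's SYMMETRISED table `symVhSAt` sits in place of the comb's `vhSAt ρ`.
The (0.4) second-order tables are PAIR-loop sums and do NOT symmetrise by summation over the axis orders; but the identity the g69 letter used survives VERBATIM: an1's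
`symVhCountAt = L^D·symHessCountAt + L^D·[f = f′]·D!·symLinCountAt − symLinCountAt ⊗ symLinCountAt` with `symHessCountAt` ANTISYMMETRIC, so
`m_sym(f,f′) + m_sym(f′,f) = [f = f′]·q_sym(f) − q_sym(f)·q_sym(f′)` (`symVhKerAt_add_swap`), and `q_sym` against a single-coordinate form is the SAME window sum as the comb's
(`symLinAvgAt_grad` reads an exact form at the two roots only): `Σ_q g(q_β)·q_sym_{(m,y)}(β,q) = [β = m]·Σ_{k<L} g(L·y_m + r_m + k)` — one point for face-supported data.

WHAT ([folklore]; generic `d`, `1 ≤ L`, in-block root `r ∈ box (d+1) L`; 0 `def`, 0 cited facts, 0 `def … : Prop`, 0 sorry): §1 `symLinAvgAt_sub'`, `symLinAvgAt_zero'`, `symLinAvgAt_add'`,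
`symLinAvgAt_finset_sum`, `symLinAvgAt_single'`, `symLinAvgAt_eq_zero_of_near`, `symLinAvgAt_congr_near`; §2 `symLinAvgAt_eq_sum_nearBox`; §3 `symLinAvgAt_coordForm`, `sum_nearBox_mul_symLinKerAt`;
§4 `symVhKerAt_add_swap`; §5 `sum_nearBox_symVhKerAt_symm_eq_zero`; §6 **`symVhSAt_classCurrent_add_swap_eq_zero`** (weighted leg first) and **`symVhSAt_classCurrent_add_swap_eq_zero'`** (free leg first).
Asserts NO value of Bałaban's tables beyond an1's DEFINED `symVhSAt`; discharges NOTHING of (C)sym ∕ (hW, hWall) ∕ (hS, hSall); NEVER «G-an2-4 closed» as (CONV-C); NOT D1, NOT `BetaPertH`,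
NOT continuum, NOT Clay.  2026-08-25; no existing file touched.
-/

noncomputable section

open Finset
open scoped BigOperators Nat
open Literature.MathematicalPhysics.QuantumFieldTheory.Balaban1983to89
open Literature.MathematicalPhysics.QuantumFieldTheory.Balaban1983to89.Beta
open AffineAveraging AveragingContours AveragingContoursRooted AveragingHessianKernels AveragingHessianKernelsRooted
open OneStepResolventKernel (Fib)
open Summit.QuantumFields.BalabanUV.Beta.LinearGaugeVH (nearBox mem_nearBox)
open Summit.QuantumFields.BalabanUV.Beta.SymmetrisedAxialPotential (symAxial symAxial_sub symLinAvgAt symLinAvgAt_grad)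
open Summit.QuantumFields.BalabanUV.Beta.SymAveragingHessianCounts (symLinU symLinU_real symLinU_single symLinCountAt symLinKerAt symVhKerAt symVhCountAt
  symHessCountAt_swap lettersIn_gammaPAt symVhKerAt_eq_zero_left symVhKerAt_eq_zero_right symVhSAt symVhSAt_symm)
open Summit.QuantumFields.BalabanUV.Beta.GAN24.VHClassCurrentSym (emod_window sum_range_face)

namespace Summit.QuantumFields.BalabanUV.Beta.GAN24.SymVHClassCurrentSym

variable {d : ℕ}

/-! ## §1 an1's symmetrised rooted averaging is additive and only reads the support box -/

section LinAvg

variable {D : ℕ}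

/-- [folklore] Additivity (differences) of `symLinAvgAt` in the one-form (from the definition: `symAxial_sub`, `segUp_sum_sub`). -/
theorem symLinAvgAt_sub' (ρ : Site D) (A A' : Form1 D ℝ) (L : ℕ) (μ : Fin D) (y : Site D) :
    symLinAvgAt ρ (A - A') L μ y = symLinAvgAt ρ A L μ y - symLinAvgAt ρ A' L μ y := by
  simp only [symLinAvgAt, symAxial_sub, segUp_sum_sub, ← Finset.sum_sub_distrib]
  refine Finset.sum_congr rfl fun b _ => ?_
  ring

/-- [folklore] `symLinAvgAt ρ 0 = 0`. -/
theorem symLinAvgAt_zero' (ρ : Site D) (L : ℕ) (μ : Fin D) (y : Site D) : symLinAvgAt ρ (0 : Form1 D ℝ) L μ y = 0 := by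
  have h := symLinAvgAt_sub' ρ (0 : Form1 D ℝ) 0 L μ y
  rwa [sub_zero, sub_self] at h

/-- [folklore] Additivity of `symLinAvgAt` in the one-form. -/
theorem symLinAvgAt_add' (ρ : Site D) (A B : Form1 D ℝ) (L : ℕ) (μ : Fin D) (y : Site D) :
    symLinAvgAt ρ (A + B) L μ y = symLinAvgAt ρ A L μ y + symLinAvgAt ρ B L μ y := by
  have h := symLinAvgAt_sub' ρ (A + B) B L μ y
  rw [add_sub_cancel_right] at h
  linarith

/-- [folklore] Finite additivity of `symLinAvgAt` in the one-form. -/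
theorem symLinAvgAt_finset_sum {ι : Type*} (ρ : Site D) (s : Finset ι) (A : ι → Form1 D ℝ) (L : ℕ) (μ : Fin D) (y : Site D) :
    symLinAvgAt ρ (∑ i ∈ s, A i) L μ y = ∑ i ∈ s, symLinAvgAt ρ (A i) L μ y := by
  classical
  induction s using Finset.induction_on with
  | empty => rw [Finset.sum_empty, Finset.sum_empty, symLinAvgAt_zero']
  | insert _ _ hi ih => rw [Finset.sum_insert hi, Finset.sum_insert hi, symLinAvgAt_add', ih]

/-- [folklore] `symLinAvgAt ρ (single f w) = symLinCountAt ρ f · w` (an1's `symLinU_single` on real forms through `symLinU_real`). -/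
theorem symLinAvgAt_single' (ρ : Site D) (f : Bond D) (w : ℝ) (L : ℕ) (μ : Fin D) (y : Site D) :
    symLinAvgAt ρ (single f w) L μ y = (symLinCountAt ρ L μ y f : ℝ) * w := by
  rw [← symLinU_real, symLinU_single, zsmul_eq_mul]

/-- [folklore] A one-form vanishing on every bond based in the support box `Near L y` has zero symmetrised rooted average (in-block root; an1's `lettersIn_gammaPAt`). -/
theorem symLinAvgAt_eq_zero_of_near {L : ℕ} {r : Fin D → ℕ} (hr : r ∈ box D L) {A : Form1 D ℝ} (μ : Fin D) (y : Site D)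
    (hA : ∀ κ x, Near L y x → A κ x = 0) : symLinAvgAt (toSite r) A L μ y = 0 := by
  rw [← symLinU_real, symLinU]
  refine Finset.sum_eq_zero fun σ _ => Finset.sum_eq_zero fun b hb => List.sum_eq_zero fun a ha => ?_
  obtain ⟨κ, x, hx, h⟩ := lettersIn_gammaPAt σ σ A L μ y hr hb a ha
  rcases h with h | h
  · rw [h, hA κ x hx]
  · rw [h, hA κ x hx, neg_zero]

/-- [folklore] Two one-forms agreeing on the support box have the same symmetrised rooted average (in-block root). -/
theorem symLinAvgAt_congr_near {L : ℕ} {r : Fin D → ℕ} (hr : r ∈ box D L) {A A' : Form1 D ℝ} (μ : Fin D) (y : Site D)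
    (h : ∀ κ x, Near L y x → A κ x = A' κ x) : symLinAvgAt (toSite r) A L μ y = symLinAvgAt (toSite r) A' L μ y := by
  have h0 := symLinAvgAt_eq_zero_of_near hr μ y (A := A - A') (fun κ x hx => by rw [Pi.sub_apply, Pi.sub_apply, h κ x hx, sub_self])
  rwa [symLinAvgAt_sub', sub_eq_zero] at h0

end LinAvg

/-! ## §2 Kernel representation of the symmetrised rooted average on the support box -/

section Kernel

/-- [folklore] **`symLinAvgAt ρ A = Σ_{x ∈ nearBox L y} Σ_κ LIN_sym(κ, x)·A κ x`** (in-block root; `LIN_sym = symLinCountAt`, an1's `symLinU_single`). -/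
theorem symLinAvgAt_eq_sum_nearBox {L : ℕ} {r : Fin (d + 1) → ℕ} (hr : r ∈ box (d + 1) L) (A : Form1 (d + 1) ℝ) (μ : Fin (d + 1))
    (y : Site (d + 1)) :
    symLinAvgAt (toSite r) A L μ y = ∑ x ∈ nearBox L y, ∑ κ : Fin (d + 1), (symLinCountAt (toSite r) L μ y (κ, x) : ℝ) * A κ x := by
  classical
  have hagree : ∀ κ x, Near L y x → A κ x = (∑ x' ∈ nearBox L y, ∑ κ' : Fin (d + 1), single (κ', x') (A κ' x')) κ x := by
    intro κ x hx
    rw [Finset.sum_apply, Finset.sum_apply]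
    simp only [Finset.sum_apply, single_apply, Prod.mk.injEq]
    rw [Finset.sum_eq_single x]
    · rw [Finset.sum_eq_single κ]
      · simp
      · intro κ' _ hκ'
        rw [if_neg fun h => hκ' h.1.symm]
      · intro h; exact absurd (Finset.mem_univ κ) h
    · intro x' _ hx'
      exact Finset.sum_eq_zero fun κ' _ => by rw [if_neg fun h => hx' h.2.symm]
    · intro h; exact absurd (mem_nearBox.2 hx) h
  rw [symLinAvgAt_congr_near hr μ y hagree, symLinAvgAt_finset_sum]
  refine Finset.sum_congr rfl fun x _ => ?_
  rw [symLinAvgAt_finset_sum]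
  refine Finset.sum_congr rfl fun κ _ => ?_
  rw [symLinAvgAt_single']

end Kernel

/-! ## §3 Single-coordinate one-forms: the symmetrised rooted average is the comb's window sum times `(d+1)!` -/

section Coord

/-- [folklore] **THE SYMMETRISED ROOTED AVERAGE OF A SINGLE-COORDINATE ONE-FORM** `(κ, x) ↦ [κ = β]·g(x_β)` over the coarse bond `(m, y)` (in-block root `r`):
`[β = m]·(d+1)!·L^{d+1}·Σ_{k<L} g(L·y_m + r_m + k)` — the form is exact on the support box and an1's `symLinAvgAt_grad` reads an exact form at the two roots only. -/
theorem symLinAvgAt_coordForm {L : ℕ} {r : Fin (d + 1) → ℕ} (hr : r ∈ box (d + 1) L) (g : ℤ → ℝ) (β m : Fin (d + 1)) (y : Site (d + 1)) :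
    symLinAvgAt (toSite r) (fun κ x => if κ = β then g (x β) else 0) L m y =
      if β = m then (((d + 1) ! : ℝ) * (L : ℝ) ^ (d + 1)) * ∑ k ∈ Finset.range L, g ((L : ℤ) * y m + (r m : ℤ) + (k : ℤ)) else 0 := by
  classical
  -- antiderivative along the `β`-coordinate, based at `L·y_β`
  set G : Site (d + 1) → ℝ := fun x => ∑ k ∈ Finset.range (x β - (L : ℤ) * y β).toNat, g ((L : ℤ) * y β + (k : ℤ)) with hG
  have hagree : ∀ κ x, Near L y x → (if κ = β then g (x β) else 0) = grad G κ x := by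
    intro κ x hx
    have hxβ : (L : ℤ) * y β ≤ x β := (hx β).1
    rw [grad]
    by_cases hκ : κ = β
    · subst hκ
      rw [if_pos rfl, hG]
      simp only [Pi.add_apply, unitVec_apply, if_true]
      rw [show (x κ + 1 - (L : ℤ) * y κ).toNat = (x κ - (L : ℤ) * y κ).toNat + 1 by omega, Finset.sum_range_succ, add_sub_cancel_left]
      congr 1
      omega
    · rw [if_neg hκ, hG]
      simp only [Pi.add_apply, unitVec_apply, if_neg (Ne.symm hκ), add_zero, sub_self]
  have hcard : (box (d + 1) L).card = L ^ (d + 1) := by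
    simp [AffineAveraging.box, Fintype.card_piFinset, Finset.card_range, Finset.prod_const, Finset.card_univ, Fintype.card_fin]
  rw [symLinAvgAt_congr_near hr m y hagree, symLinAvgAt_grad, hcard, Nat.cast_pow]
  have hrm : ∀ i, r i < L := by simpa [AffineAveraging.box, Fintype.mem_piFinset, Finset.mem_range] using hr
  by_cases hβ : β = m
  · subst hβ
    rw [if_pos rfl, hG]
    simp only [Pi.add_apply, Pi.smul_apply, smul_eq_mul, toSite, unitVec_apply, if_true, mul_one]
    rw [show ((L : ℤ) * y β + (r β : ℤ) + (L : ℤ) - (L : ℤ) * y β).toNat = r β + L by omega,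
      show ((L : ℤ) * y β + (r β : ℤ) - (L : ℤ) * y β).toNat = r β by omega, Finset.sum_range_add, add_sub_cancel_left]
    have e : ∀ k : ℕ, g ((L : ℤ) * y β + ((r β + k : ℕ) : ℤ)) = g ((L : ℤ) * y β + (r β : ℤ) + (k : ℤ)) := fun k => by
      push_cast
      ring_nf
    simp only [e]
  · rw [if_neg hβ, hG]
    simp only [Pi.add_apply, Pi.smul_apply, smul_eq_mul, toSite, unitVec_apply, if_neg hβ, mul_zero, add_zero, sub_self, mul_zero]

/-- [folklore] **THE WINDOW SUM**: `Σ_{q ∈ nearBox L y} g(q_β)·q_sym_{(m,y)}(β,q) = [β = m]·Σ_{k<L} g(L·y_m + r_m + k)` (`q_sym = symLinKerAt = symLinCountAt ∕ ((d+1)!·L^{d+1})`, in-block root) —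
the SAME window as the comb's `VHClassCurrentSym.sum_nearBox_mul_linKerAt`. -/
theorem sum_nearBox_mul_symLinKerAt {L : ℕ} (hL : 1 ≤ L) {r : Fin (d + 1) → ℕ} (hr : r ∈ box (d + 1) L) (g : ℤ → ℝ) (β m : Fin (d + 1))
    (y : Site (d + 1)) :
    ∑ q ∈ nearBox L y, g (q β) * symLinKerAt (toSite r) L m y (β, q) =
      if β = m then ∑ k ∈ Finset.range L, g ((L : ℤ) * y m + (r m : ℤ) + (k : ℤ)) else 0 := by
  classical
  have hfac : (0 : ℝ) < ((d + 1) ! : ℝ) := by exact_mod_cast Nat.factorial_pos (d + 1)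
  have hLD : (0 : ℝ) < ((d + 1) ! : ℝ) * (L : ℝ) ^ (d + 1) := by positivity
  have h := symLinAvgAt_eq_sum_nearBox hr (fun κ x => if κ = β then g (x β) else 0) m y
  rw [symLinAvgAt_coordForm hr g β m y] at h
  have e : ∑ x ∈ nearBox L y, ∑ κ : Fin (d + 1), (symLinCountAt (toSite r) L m y (κ, x) : ℝ) * (if κ = β then g (x β) else 0) =
      (((d + 1) ! : ℝ) * (L : ℝ) ^ (d + 1)) * ∑ q ∈ nearBox L y, g (q β) * symLinKerAt (toSite r) L m y (β, q) := by
    rw [Finset.mul_sum]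
    refine Finset.sum_congr rfl fun x _ => ?_
    rw [Finset.sum_eq_single β (fun κ _ hκ => by rw [if_neg hκ, mul_zero]) (fun h => absurd (Finset.mem_univ β) h), if_pos rfl, symLinKerAt]
    symm
    rw [mul_div_assoc', mul_div_assoc', mul_div_cancel_left₀ _ hLD.ne', mul_comm]
  rw [e] at h
  split_ifs at h with hβ
  · rw [if_pos hβ]
    exact mul_left_cancel₀ hLD.ne' h.symm
  · rw [if_neg hβ]
    have := h.symm
    rwa [mul_eq_zero, or_iff_right hLD.ne'] at this

end Coord

/-! ## §4 The symmetrised border kernel, slot↔leg-symmetrised -/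

section Kernel2

/-- [folklore] **`m_sym(f,f′) + m_sym(f′,f) = [f = f′]·q_sym(f) − q_sym(f)·q_sym(f′)`** — an1's `symVhCountAt = L^D·symHessCountAt + L^D·[f=f′]·D!·symLinCountAt − symLinCountAt⊗symLinCountAt`,
the antisymmetric `symHessCountAt` drops (`symHessCountAt_swap`); normalisations `symVhKerAt = VH∕(2(D!)²L^{2D})`, `symLinKerAt = LIN∕(D!·L^D)`. -/
theorem symVhKerAt_add_swap {D : ℕ} {L : ℕ} (hL : 1 ≤ L) (ρ : Fin D → ℤ) (μ : Fin D) (y : Fin D → ℤ) (f f' : Bond D) :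
    symVhKerAt ρ L μ y f f' + symVhKerAt ρ L μ y f' f = (if f = f' then symLinKerAt ρ L μ y f else 0) - symLinKerAt ρ L μ y f * symLinKerAt ρ L μ y f' := by
  have hL0 : (L : ℝ) ≠ 0 := by exact_mod_cast (Nat.one_le_iff_ne_zero.mp hL)
  have hfac : ((D ! : ℕ) : ℝ) ≠ 0 := by exact_mod_cast (Nat.factorial_pos D).ne'
  rw [symVhKerAt, symVhKerAt, symVhCountAt, symVhCountAt, symHessCountAt_swap ρ L μ y f f', symLinKerAt, symLinKerAt]
  by_cases hf : f = f'
  · subst hf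
    simp only [if_true]
    push_cast
    field_simp
    ring
  · rw [if_neg hf, if_neg (Ne.symm hf), if_neg hf]
    push_cast
    field_simp
    ring

end Kernel2

/-! ## §5 Face-supported data: the window holds one point (g69's `emod_window` ∕ `sum_range_face` BY NAME) -/

section Face

/-- [folklore] **THE SLOT↔LEG-SYMMETRISED SYMMETRISED BORDER KERNEL AGAINST TWO FACE-SUPPORTED SINGLE-COORDINATE DATA VANISHES** (finite form on the support box):
`Σ_{q,u ∈ nearBox L y} h(q_β)s(u_ν)·(m_sym_{(m,y)}((β,q),(ν,u)) + m_sym_{(m,y)}((ν,u),(β,q))) = 0`. -/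
theorem sum_nearBox_symVhKerAt_symm_eq_zero {L : ℕ} (hL : 1 ≤ L) {r : Fin (d + 1) → ℕ} (hr : r ∈ box (d + 1) L) (β ν m : Fin (d + 1))
    (y : Site (d + 1)) {h s : ℤ → ℝ} (hh : ∀ n : ℤ, n % (L : ℤ) ≠ (L : ℤ) - 1 → h n = 0) (hs : ∀ n : ℤ, n % (L : ℤ) ≠ (L : ℤ) - 1 → s n = 0) :
    ∑ q ∈ nearBox L y, ∑ u ∈ nearBox L y, h (q β) * s (u ν) *
      (symVhKerAt (toSite r) L m y (β, q) (ν, u) + symVhKerAt (toSite r) L m y (ν, u) (β, q)) = 0 := by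
  classical
  have hrm : ∀ i, r i < L := by simpa [AffineAveraging.box, Fintype.mem_piFinset, Finset.mem_range] using hr
  simp_rw [symVhKerAt_add_swap hL, mul_sub, Finset.sum_sub_distrib]
  -- the diagonal term
  have hdiag : ∑ q ∈ nearBox L y, ∑ u ∈ nearBox L y, h (q β) * s (u ν) * (if ((β, q) : Bond (d + 1)) = (ν, u) then symLinKerAt (toSite r) L m y (β, q) else 0) =
      if β = ν then ∑ q ∈ nearBox L y, (h (q β) * s (q β)) * symLinKerAt (toSite r) L m y (β, q) else 0 := by
    by_cases hβν : β = ν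
    · subst hβν
      rw [if_pos rfl]
      refine Finset.sum_congr rfl fun q hq => ?_
      rw [Finset.sum_eq_single q]
      · simp
      · intro u _ hu
        rw [if_neg fun e => hu ((Prod.mk.injEq _ _ _ _).mp e).2.symm, mul_zero]
      · intro hq'; exact absurd hq hq'
    · rw [if_neg hβν]
      refine Finset.sum_eq_zero fun q _ => Finset.sum_eq_zero fun u _ => ?_
      rw [if_neg fun e => hβν ((Prod.mk.injEq _ _ _ _).mp e).1, mul_zero]
  -- the product term
  have hprod : ∑ q ∈ nearBox L y, ∑ u ∈ nearBox L y, h (q β) * s (u ν) * (symLinKerAt (toSite r) L m y (β, q) * symLinKerAt (toSite r) L m y (ν, u)) =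
      (∑ q ∈ nearBox L y, h (q β) * symLinKerAt (toSite r) L m y (β, q)) * ∑ u ∈ nearBox L y, s (u ν) * symLinKerAt (toSite r) L m y (ν, u) := by
    rw [Finset.sum_mul_sum]
    exact Finset.sum_congr rfl fun q _ => Finset.sum_congr rfl fun u _ => by ring
  rw [hdiag, hprod, sum_nearBox_mul_symLinKerAt hL hr h β m y, sum_nearBox_mul_symLinKerAt hL hr s ν m y]
  by_cases hβν : β = ν
  · subst hβν
    rw [if_pos rfl, sum_nearBox_mul_symLinKerAt hL hr (fun n => h n * s n) β m y]
    by_cases hβm : β = m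
    · subst hβm
      simp only [if_true]
      have e3 := sum_range_face hL (hrm β) (fun n => h n * s n) (fun n hn => by simp [hh n hn]) (y β)
      rw [e3, sum_range_face hL (hrm β) h hh (y β), sum_range_face hL (hrm β) s hs (y β), sub_self]
    · simp only [if_neg hβm, zero_mul, sub_self]
  · rw [if_neg hβν]
    by_cases hβm : β = m
    · subst hβm
      rw [if_pos rfl, if_neg (Ne.symm hβν), mul_zero, sub_self]
    · rw [if_neg hβm, zero_mul, sub_self]

end Face

/-! ## §6 The letter -/

section Letter

/-- [folklore] **THE (III′) VH LETTER (weighted leg first, free leg second)**: for exit-face-supported single-coordinate data `h` (direction `β`) and `s` (direction `ν`), `1 ≤ L`, in-block root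
`r ∈ box L`, every free leg `(p, a)`:
`Σ'_q h(q_β)·Σ'_u s(u_ν)·symVhSAt ρ d L ν u q p (inl β) a + Σ'_q s(q_ν)·Σ'_u h(u_β)·symVhSAt ρ d L β u q p (inl ν) a = 0`
(field free legs: no ff block; multiplier free leg `(p, inr m)`, `p` coarse: the symmetrised kernel of the coarse bond `(m, p∕L)`, §5). -/
theorem symVhSAt_classCurrent_add_swap_eq_zero {L : ℕ} (hL : 1 ≤ L) {r : Fin (d + 1) → ℕ} (hr : r ∈ box (d + 1) L) (ν β : Fin (d + 1))
    {h s : ℤ → ℝ} (hh : ∀ n : ℤ, n % (L : ℤ) ≠ (L : ℤ) - 1 → h n = 0) (hs : ∀ n : ℤ, n % (L : ℤ) ≠ (L : ℤ) - 1 → s n = 0)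
    (p : Site (d + 1)) (a : Fib d) :
    (∑' q : Site (d + 1), h (q β) * ∑' u : Site (d + 1), s (u ν) * symVhSAt (toSite r) d L rfl ν u q p (Sum.inl β) a) +
      ∑' q : Site (d + 1), s (q ν) * ∑' u : Site (d + 1), h (u β) * symVhSAt (toSite r) d L rfl β u q p (Sum.inl ν) a = 0 := by
  classical
  rcases a with α | m
  · simp [symVhSAt]
  · by_cases hp : off L p = 0
    · simp only [symVhSAt, packVH_inl_inr, if_pos hp]
      set y := blk L p with hy
      -- both double `tsum`s are finite sums over the support box
      have hin : ∀ (g : ℤ → ℝ) (κ κ' : Fin (d + 1)) (q : Site (d + 1)),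
          ∑' u : Site (d + 1), g (u κ) * symVhKerAt (toSite r) L m y (κ', q) (κ, u) = ∑ u ∈ nearBox L y, g (u κ) * symVhKerAt (toSite r) L m y (κ', q) (κ, u) := by
        intro g κ κ' q
        refine tsum_eq_sum fun u hu => ?_
        rw [symVhKerAt_eq_zero_right hr _ (f' := (κ, u)) (fun hn => hu (mem_nearBox.2 hn)), mul_zero]
      have hout : ∀ (g g' : ℤ → ℝ) (κ κ' : Fin (d + 1)),
          ∑' q : Site (d + 1), g' (q κ') * ∑ u ∈ nearBox L y, g (u κ) * symVhKerAt (toSite r) L m y (κ', q) (κ, u) =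
            ∑ q ∈ nearBox L y, g' (q κ') * ∑ u ∈ nearBox L y, g (u κ) * symVhKerAt (toSite r) L m y (κ', q) (κ, u) := by
        intro g g' κ κ'
        refine tsum_eq_sum fun q hq => ?_
        rw [Finset.sum_eq_zero fun u _ => by rw [symVhKerAt_eq_zero_left hr (f := (κ', q)) (fun hn => hq (mem_nearBox.2 hn)), mul_zero], mul_zero]
      simp_rw [hin]
      rw [hout s h ν β, hout h s β ν]
      simp_rw [Finset.mul_sum]
      rw [Finset.sum_comm (s := nearBox L y) (t := nearBox L y) (f := fun q u => s (q ν) * (h (u β) * symVhKerAt (toSite r) L m y (ν, q) (β, u))),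
        ← Finset.sum_add_distrib]
      simp_rw [← Finset.sum_add_distrib]
      rw [← sum_nearBox_symVhKerAt_symm_eq_zero hL hr β ν m y hh hs]
      exact Finset.sum_congr rfl fun q _ => Finset.sum_congr rfl fun u _ => by ring
    · simp only [symVhSAt, packVH_inl_inr, if_neg hp, mul_zero, tsum_zero, add_zero]

/-- [folklore] **THE (III′) VH LETTER (free leg first, weighted leg second)** — `symVhSAt` is symmetric (an1's `symVhSAt_symm`). -/
theorem symVhSAt_classCurrent_add_swap_eq_zero' {L : ℕ} (hL : 1 ≤ L) {r : Fin (d + 1) → ℕ} (hr : r ∈ box (d + 1) L) (ν β : Fin (d + 1))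
    {h s : ℤ → ℝ} (hh : ∀ n : ℤ, n % (L : ℤ) ≠ (L : ℤ) - 1 → h n = 0) (hs : ∀ n : ℤ, n % (L : ℤ) ≠ (L : ℤ) - 1 → s n = 0)
    (p : Site (d + 1)) (a : Fib d) :
    (∑' q : Site (d + 1), h (q β) * ∑' u : Site (d + 1), s (u ν) * symVhSAt (toSite r) d L rfl ν u p q a (Sum.inl β)) +
      ∑' q : Site (d + 1), s (q ν) * ∑' u : Site (d + 1), h (u β) * symVhSAt (toSite r) d L rfl β u p q a (Sum.inl ν) = 0 := by
  have e : ∀ (κ τ : Fin (d + 1)) (u q : Site (d + 1)), symVhSAt (toSite r) d L rfl κ u p q a (Sum.inl τ) = symVhSAt (toSite r) d L rfl κ u q p (Sum.inl τ) a :=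
    fun κ τ u q => symVhSAt_symm (toSite r) L κ u p q a (Sum.inl τ)
  simp_rw [e]
  exact symVhSAt_classCurrent_add_swap_eq_zero hL hr ν β hh hs p a

end Letter

end Summit.QuantumFields.BalabanUV.Beta.GAN24.SymVHClassCurrentSym

end
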